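import Summits.BirchSwinnertonDyer.Rank1Residual.GaloisImage.SelmerStructureTransportCoisotropic
import HarnessLib

/-!
# The dual map `e^D : M̄^D → M^D` of an equivariant map `e : M → M̄` as an intertwining map of Tate
# duals, and the parameter-free forms of FILE F1a/F1a′ (cell `b2b-bsdres`, team n1011, seat p16 GEN 6;
# row T-R1-56-F1, FILE F1b; skeleton `cells/n1011/skel/T-R1-56-F1.md`)

HONEST FRAMING (cell `b2b-bsdres`, run/shared/lean/b2b/bsd-rank1-residual/, verbatim in every
file): the goal of the cell is to DELETE the COMBINATION-SHAPED residual classes of the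
Birch–Swinnerton-Dyer formula for ALL analytic-rank `≤ 1` elliptic curves over `ℚ` — "full BSD
formula for every rank `≤ 1` curve in class `C`" assembled STRICTLY from published theorems — so
that the rank-`≤ 1` remainder becomes exactly the CONSTRUCTION-SHAPED classes, which are TYPED
(missing-input `Prop`s), NOT attempted. This is not "finishing BSD". Team n1011 (N10 / N11 / O7):
research route on the CONSTRUCTION-SHAPED class X4 (N11 = X4 ∧ p = 3); prove what is provable now; no
claim beyond stated classes; TOOL theorems about Selmer structures of finite Galois modules; nothing
booked; no mark / label moved. THREE definitions with bodies (the dual map `e^D`, its auxiliary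
additive map, the inverse of a bijective intertwining map) and theorems; no named fact, no `sorry`.

## What

FILE F1a (`SelmerStructureTransport`) / F1a′ (`SelmerStructureTransportCoisotropic`) carry the dual
side of an equivariant bijection `e : M ⥲ M̄` as PARAMETERS `eD : M̄^D →ⁱL M^D`, `eD'` with the
pointwise formulas `(eD f)(a) = f(e a)`. This file CONSTRUCTS that map:
* `tateDualComapHom e : Hom(M̄, μₙ) →+ Hom(M, μₙ)`, `f ↦ f ∘ e` (auxiliary additive map);
* **`tateDualComap e : (ρbar.tateDual n) →ⁱL (ρ.tateDual n)`** — continuous and `Γ_K`-equivariant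
  (`σ • (f ∘ e) = (σ • f) ∘ e` by equivariance of `e`; Milne I §2, functoriality of `M ↦ M^D`), with
  `tateDualComap_apply_apply : tateDualComap e f a = f (e a)` (`rfl`) = the `heD` of F1a;
* `inverseOfBijective e he : M₂ →ⁱL M₁` — the inverse of a BIJECTIVE intertwining map of discrete
  modules (generic `weilDualInv`; FILE F: `θ̄⁻¹` from the slice's `Bijective θ̄`), with
  `apply_inverseOfBijective` / `inverseOfBijective_apply`;
* the `Nat.log` form `lambdaStar_induced_eq_zero_iff` (`λ^*(𝓕̄) = 0 ↔ H¹_{𝓕^*}(K, M^D) = ⊥`, binder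
  currency `[Finite (inv.dualSelmerStructure ρ 𝓕).selmerGroup]` + `hpD : ∀ y, p • y = 0`);
* the parameter-free corollaries for FILE F (p13): `natCard_dualSelmerGroup_induced_eq_comap`,
  `hasCoreRank_induced_iff_comap`, `lambdaStar_induced_eq_comap`, `lambdaStar_induced_eq_zero_iff_comap`,
  `isResiduallyCoisotropic_of_induced_comap` (self-duality `tateDualComap e ∘ θ ∘ e` on `M`);
* §H the transported self-duality `θ_M := e^D ∘ θ ∘ e` has the transported inverse
  `θ'_M := e' ∘ θ' ∘ e'^D` (`transportedSelfDual_left_inv` / `_right_inv` / `_bijective`) — the (H.SD)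
  bijection of the slice moved from `M̄` to `M` in p11's `(θ, θ′, hθθ′, hθ′θ)` currency.

References: [MilneADT2006] Ch. I §2 (`M^D = Hom(M, μₙ)`); [Sakamoto2024] §2, §3.1.1, Def. 3.6, Def. 3.8;
[Howard2004HeegnerKolyvagin] Def. 2.1.10.
-/

noncomputable section

open scoped Classical

open Function NumberField IsDedekindDomain Field
open Literature.NumberTheory.GaloisRepresentations
open Literature.NumberTheory.GaloisRepresentations.DiscreteGaloisModule
open Literature.NumberTheory.GaloisCohomology
open scoped ContRepresentation

universe u

namespace Summit.BirchSwinnertonDyer.Rank1Residual.GaloisImage.Transport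

section DualDef

variable {K : Type u} [Field K] {M Mbar : Type u}
  [AddCommGroup M] [TopologicalSpace M] [DiscreteTopology M]
  [AddCommGroup Mbar] [TopologicalSpace Mbar] [DiscreteTopology Mbar]
  {ρ : DiscreteGaloisModule K M} {ρbar : DiscreteGaloisModule K Mbar} {n : ℕ}

/-- Precomposition with an equivariant map `e : M → M̄` as an additive map
`Hom(M̄, μₙ) → Hom(M, μₙ)`, `f ↦ f ∘ e` (auxiliary). [folklore] -/
def tateDualComapHom (e : ρ.toContRepresentation →ⁱL ρbar.toContRepresentation) :
    TateDual K Mbar n →+ TateDual K M n where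
  toFun f := ((f : Mbar →+ Additive (rootsOfUnity n (AlgebraicClosure K))).comp
    (e.toContinuousLinearMap.toLinearMap.toAddMonoidHom) : M →+ Additive (rootsOfUnity n (AlgebraicClosure K)))
  map_zero' := rfl
  map_add' _ _ := rfl

/-- Unfolding: `(tateDualComapHom e f) a = f (e a)`. [folklore] -/
@[simp] theorem tateDualComapHom_apply_apply (e : ρ.toContRepresentation →ⁱL ρbar.toContRepresentation)
    (f : TateDual K Mbar n) (a : M) : tateDualComapHom e f a = f (e a) := rfl

variable [Finite M] [Finite Mbar]

/-- **The dual map `e^D : M̄^D → M^D`, `f ↦ f ∘ e`, of an equivariant map `e : M → M̄`, as a continuous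
`Γ_K`-intertwining map of the Tate duals** (`(σ • (f ∘ e))(a) = σ f(e(σ⁻¹ a)) = σ f(σ⁻¹ e a)
= ((σ • f) ∘ e)(a)` by equivariance of `e`; continuity: discrete). Milne, *ADT* I §2
(functoriality of `M ↦ M^D`). [cite: MilneADT2006, Ch. I §2] -/
def tateDualComap (e : ρ.toContRepresentation →ⁱL ρbar.toContRepresentation) :
    (ρbar.tateDual n).toContRepresentation →ⁱL (ρ.tateDual n).toContRepresentation where
  toContinuousLinearMap := ⟨(tateDualComapHom e).toIntLinearMap, continuous_of_discreteTopology⟩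
  isIntertwining' σ := by
    refine ContinuousLinearMap.ext fun f ↦ TateDual.ext fun a ↦ ?_
    change tateDualComapHom e ((ρbar.tateDual n).toContRepresentation σ f) a =
      (ρ.tateDual n).toContRepresentation σ (tateDualComapHom e f) a
    rw [ContinuousRep.toContRepresentation_apply_apply, ContinuousRep.toContRepresentation_apply_apply,
      tateDualComapHom_apply_apply, tateDual_apply_apply_apply, tateDual_apply_apply_apply,
      tateDualComapHom_apply_apply]
    congr 2
    have h := e.isIntertwining σ⁻¹ a
    simp only [ContinuousRep.toContRepresentation_apply_apply] at h
    exact h.symm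

/-- **`(e^D f)(a) = f(e a)`** — the pointwise formula (`heD` of FILE F1a). [cite: MilneADT2006, Ch. I §2] -/
@[simp] theorem tateDualComap_apply_apply (e : ρ.toContRepresentation →ⁱL ρbar.toContRepresentation)
    (f : TateDual K Mbar n) (a : M) : tateDualComap e f a = f (e a) := rfl

end DualDef


/-! ## The inverse of a bijective intertwining map of discrete modules -/

section Inverse

variable {F : Type u} [Field F] {M₁ M₂ : Type u}
  [AddCommGroup M₁] [TopologicalSpace M₁] [DiscreteTopology M₁]
  [AddCommGroup M₂] [TopologicalSpace M₂] [DiscreteTopology M₂]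
  {ρ₁ : DiscreteGaloisModule F M₁} {ρ₂ : DiscreteGaloisModule F M₂}

/-- **The inverse of a BIJECTIVE continuous intertwining map `e : M₁ ⥲ M₂` of discrete `Γ_F`-modules,
as a continuous intertwining map `M₂ →ⁱL M₁`** (the inverse additive bijection; equivariant because
`e` is; continuous because `M₁` is discrete) — the generic form of X11b's `weilDualInv`; for FILE F:
`θ̄⁻¹` from the slice's `Function.Bijective θ̄` (H.SD). [cite: Sakamoto2024, §2 (H.SD) (p. 921)] -/
def inverseOfBijective (e : ρ₁.toContRepresentation →ⁱL ρ₂.toContRepresentation)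
    (he : Function.Bijective e) : ρ₂.toContRepresentation →ⁱL ρ₁.toContRepresentation where
  toContinuousLinearMap :=
    ⟨((AddEquiv.ofBijective (e : M₁ →+ M₂) he).symm.toAddMonoidHom).toIntLinearMap,
      continuous_of_discreteTopology⟩
  isIntertwining' σ := by
    refine ContinuousLinearMap.ext fun b ↦ ?_
    change (AddEquiv.ofBijective (e : M₁ →+ M₂) he).symm (ρ₂.toContRepresentation σ b) =
      ρ₁.toContRepresentation σ ((AddEquiv.ofBijective (e : M₁ →+ M₂) he).symm b)
    apply he.1
    rw [e.isIntertwining σ]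
    change (AddEquiv.ofBijective (e : M₁ →+ M₂) he) ((AddEquiv.ofBijective (e : M₁ →+ M₂) he).symm _) =
      ρ₂.toContRepresentation σ ((AddEquiv.ofBijective (e : M₁ →+ M₂) he)
        ((AddEquiv.ofBijective (e : M₁ →+ M₂) he).symm b))
    rw [AddEquiv.apply_symm_apply, AddEquiv.apply_symm_apply]

/-- `e (e⁻¹ b) = b`. [folklore] -/
@[simp] theorem apply_inverseOfBijective (e : ρ₁.toContRepresentation →ⁱL ρ₂.toContRepresentation)
    (he : Function.Bijective e) (b : M₂) : e (inverseOfBijective e he b) = b :=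
  (AddEquiv.ofBijective (e : M₁ →+ M₂) he).apply_symm_apply b

/-- `e⁻¹ (e a) = a`. [folklore] -/
@[simp] theorem inverseOfBijective_apply (e : ρ₁.toContRepresentation →ⁱL ρ₂.toContRepresentation)
    (he : Function.Bijective e) (a : M₁) : inverseOfBijective e he (e a) = a :=
  (AddEquiv.ofBijective (e : M₁ →+ M₂) he).symm_apply_apply a

end Inverse

/-! ## The `Nat.log` form of `λ^*` (binder currency: `[Finite …]` instance + `hpD`) -/

section Log

variable {K : Type u} [Field K] [NumberField K] {M Mbar : Type u}
  [AddCommGroup M] [TopologicalSpace M] [DiscreteTopology M] [Finite M]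
  [AddCommGroup Mbar] [TopologicalSpace Mbar] [DiscreteTopology Mbar] [Finite Mbar]
  {ρ : DiscreteGaloisModule K M} {ρbar : DiscreteGaloisModule K Mbar} {n : ℕ}
  (e : ρ.toContRepresentation →ⁱL ρbar.toContRepresentation)
  (e' : ρbar.toContRepresentation →ⁱL ρ.toContRepresentation)
  (eD : (ρbar.tateDual n).toContRepresentation →ⁱL (ρ.tateDual n).toContRepresentation)
  (eD' : (ρ.tateDual n).toContRepresentation →ⁱL (ρbar.tateDual n).toContRepresentation)
  (inv : LocalInvariants K n) (𝓕 : SelmerStructure ρ)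

/-- **`λ^*(𝓕̄) = 0 ↔ H¹_{𝓕^*}(K, M^D) = 0`** for `𝓕̄ = 𝓕.induced e` (T2 + the log form; the dual Selmer
group of `𝓕` finite and `M^D` killed by the prime `p` — e.g. `n = p`): the shape in which the slice
`Sakamoto2024.kolyvaginSystems_freeRankOne_zmod_three_pow_at 1` states "`d` is a core vertex".
[cite: Sakamoto2024, §3.1.1 (p. 923) and Thm. 4.4 (1) (p. 926)] -/
theorem lambdaStar_induced_eq_zero_iff {p : ℕ} [Fact p.Prime] (hee' : ∀ a, e' (e a) = a)
    (he'e : ∀ b, e (e' b) = b) (heD : ∀ (f : TateDual K Mbar n) (a : M), eD f a = f (e a))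
    (heD' : ∀ (g : TateDual K M n) (b : Mbar), eD' g b = g (e' b))
    (hpD : ∀ y : galoisCohomology (ρ.tateDual n) 1, p • y = 0)
    [Finite (inv.dualSelmerStructure ρ 𝓕).selmerGroup] :
    LocalInvariants.lambdaStar inv (𝓕.induced e) p = 0 ↔
      (inv.dualSelmerStructure ρ 𝓕).selmerGroup = ⊥ := by
  rw [lambdaStar_induced_eq e e' eD eD' inv 𝓕 hee' he'e heD heD', LocalInvariants.lambdaStar]
  exact natLog_natCard_eq_zero_iff hpD _

end Log

/-! ## Parameter-free corollaries with `eD := tateDualComap e` -/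

section Corollaries

variable {K : Type u} [Field K] [NumberField K] {M Mbar : Type u}
  [AddCommGroup M] [TopologicalSpace M] [DiscreteTopology M] [Finite M]
  [AddCommGroup Mbar] [TopologicalSpace Mbar] [DiscreteTopology Mbar] [Finite Mbar]
  {ρ : DiscreteGaloisModule K M} {ρbar : DiscreteGaloisModule K Mbar} {n : ℕ}
  (e : ρ.toContRepresentation →ⁱL ρbar.toContRepresentation)
  (e' : ρbar.toContRepresentation →ⁱL ρ.toContRepresentation)
  (inv : LocalInvariants K n) (𝓕 : SelmerStructure ρ)

/-- (T2) with the canonical dual maps: `#H¹_{𝓕̄^*}(K, M̄^D) = #H¹_{𝓕^*}(K, M^D)`.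
[cite: Howard2004HeegnerKolyvagin, Def. 2.1.10 (arXiv:1202.6340 p. 6)] -/
theorem natCard_dualSelmerGroup_induced_eq_comap (hee' : ∀ a, e' (e a) = a) (he'e : ∀ b, e (e' b) = b) :
    Nat.card (inv.dualSelmerStructure ρbar (𝓕.induced e)).selmerGroup =
      Nat.card (inv.dualSelmerStructure ρ 𝓕).selmerGroup :=
  natCard_dualSelmerGroup_induced_eq e e' (tateDualComap e) (tateDualComap e') inv 𝓕 hee' he'e
    (fun _ _ => rfl) (fun _ _ => rfl)

/-- Core rank with the canonical dual maps: `χ(𝓕̄) = r ↔ χ(𝓕) = r`. [cite: Sakamoto2024, Def. 3.6 (p. 923)] -/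
theorem hasCoreRank_induced_iff_comap (hee' : ∀ a, e' (e a) = a) (he'e : ∀ b, e (e' b) = b) (p r : ℕ) :
    LocalInvariants.HasCoreRank inv (𝓕.induced e) p r ↔ LocalInvariants.HasCoreRank inv 𝓕 p r :=
  hasCoreRank_induced_iff e e' (tateDualComap e) (tateDualComap e') inv 𝓕 hee' he'e
    (fun _ _ => rfl) (fun _ _ => rfl) p r

/-- `λ^*(𝓕̄) = λ^*(𝓕)` with the canonical dual maps. [cite: Sakamoto2024, §3.1.1 (p. 923)] -/
theorem lambdaStar_induced_eq_comap (hee' : ∀ a, e' (e a) = a) (he'e : ∀ b, e (e' b) = b) (p : ℕ) :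
    LocalInvariants.lambdaStar inv (𝓕.induced e) p = LocalInvariants.lambdaStar inv 𝓕 p :=
  lambdaStar_induced_eq e e' (tateDualComap e) (tateDualComap e') inv 𝓕 hee' he'e
    (fun _ _ => rfl) (fun _ _ => rfl) p

/-- `λ^*(𝓕̄) = 0 ↔ H¹_{𝓕^*}(K, M^D) = ⊥` with the canonical dual maps.
[cite: Sakamoto2024, §3.1.1 (p. 923) and Thm. 4.4 (1) (p. 926)] -/
theorem lambdaStar_induced_eq_zero_iff_comap {p : ℕ} [Fact p.Prime] (hee' : ∀ a, e' (e a) = a)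
    (he'e : ∀ b, e (e' b) = b) (hpD : ∀ y : galoisCohomology (ρ.tateDual n) 1, p • y = 0)
    [Finite (inv.dualSelmerStructure ρ 𝓕).selmerGroup] :
    LocalInvariants.lambdaStar inv (𝓕.induced e) p = 0 ↔
      (inv.dualSelmerStructure ρ 𝓕).selmerGroup = ⊥ :=
  lambdaStar_induced_eq_zero_iff e e' (tateDualComap e) (tateDualComap e') inv 𝓕 hee' he'e
    (fun _ _ => rfl) (fun _ _ => rfl) hpD

/-- (T4) with the canonical dual map: residual coisotropy of `(𝓕̄, θ)` on `S` gives residual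
coisotropy of `(𝓕, e^D ∘ θ ∘ e)` on `S`. [cite: Sakamoto2024, Def. 3.8 (p. 924)] -/
theorem isResiduallyCoisotropic_of_induced_comap (hee' : ∀ a, e' (e a) = a)
    (θ : ρbar.toContRepresentation →ⁱL (ρbar.tateDual n).toContRepresentation) {S : Finset (Place K)}
    (h : inv.IsResiduallyCoisotropic (𝓕.induced e) θ S) :
    inv.IsResiduallyCoisotropic 𝓕 ((tateDualComap e).comp (θ.comp e)) S :=
  isResiduallyCoisotropic_of_induced e e' (tateDualComap e) inv 𝓕 θ hee' (fun _ _ => rfl) h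

end Corollaries

/-! ## §H The transported self-duality `e^D ∘ θ ∘ e` and its inverse -/

section SelfDual

variable {K : Type u} [Field K] {M Mbar : Type u}
  [AddCommGroup M] [TopologicalSpace M] [DiscreteTopology M] [Finite M]
  [AddCommGroup Mbar] [TopologicalSpace Mbar] [DiscreteTopology Mbar] [Finite Mbar]
  {ρ : DiscreteGaloisModule K M} {ρbar : DiscreteGaloisModule K Mbar} {n : ℕ}
  (e : ρ.toContRepresentation →ⁱL ρbar.toContRepresentation)
  (e' : ρbar.toContRepresentation →ⁱL ρ.toContRepresentation)
  (θ : ρbar.toContRepresentation →ⁱL (ρbar.tateDual n).toContRepresentation)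
  (θ' : (ρbar.tateDual n).toContRepresentation →ⁱL ρbar.toContRepresentation)

/-- `(e'^D) (e^D f) = f` when `e ∘ e' = id`. [cite: MilneADT2006, Ch. I §2] -/
theorem tateDualComap_tateDualComap_apply (he'e : ∀ b, e (e' b) = b) (f : TateDual K Mbar n) :
    tateDualComap e' (tateDualComap e f) = f :=
  TateDual.ext fun b => by rw [tateDualComap_apply_apply, tateDualComap_apply_apply, he'e]

/-- **The transported self-duality has the transported inverse (left)**: with
`θ_M := e^D ∘ θ ∘ e : M → M^D` and `θ'_M := e' ∘ θ' ∘ e'^D : M^D → M`, `θ'_M (θ_M a) = a`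
(from `e' ∘ e = id`, `e ∘ e' = id`, `θ' ∘ θ = id`). [cite: Sakamoto2024, §2 (H.SD) (p. 921)] -/
theorem transportedSelfDual_left_inv (hee' : ∀ a, e' (e a) = a) (he'e : ∀ b, e (e' b) = b)
    (hθθ' : ∀ b, θ' (θ b) = b) (a : M) :
    (e'.comp (θ'.comp (tateDualComap e'))) (((tateDualComap e).comp (θ.comp e)) a) = a := by
  change e' (θ' (tateDualComap e' (tateDualComap e (θ (e a))))) = a
  rw [tateDualComap_tateDualComap_apply e e' he'e, hθθ', hee']

/-- **The transported self-duality has the transported inverse (right)**: `θ_M (θ'_M g) = g`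
(from `e' ∘ e = id`, `e ∘ e' = id`, `θ ∘ θ' = id`). [cite: Sakamoto2024, §2 (H.SD) (p. 921)] -/
theorem transportedSelfDual_right_inv (hee' : ∀ a, e' (e a) = a) (he'e : ∀ b, e (e' b) = b)
    (hθ'θ : ∀ g, θ (θ' g) = g) (g : TateDual K M n) :
    ((tateDualComap e).comp (θ.comp e)) ((e'.comp (θ'.comp (tateDualComap e'))) g) = g := by
  change tateDualComap e (θ (e (e' (θ' (tateDualComap e' g))))) = g
  rw [he'e, hθ'θ]
  exact TateDual.ext fun a => by rw [tateDualComap_apply_apply, tateDualComap_apply_apply, hee']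

/-- Bijectivity of the transported self-duality `e^D ∘ θ ∘ e` from that of `θ` (and `e`).
[cite: Sakamoto2024, §2 (H.SD) (p. 921)] -/
theorem transportedSelfDual_bijective (hee' : ∀ a, e' (e a) = a) (he'e : ∀ b, e (e' b) = b)
    (hθθ' : ∀ b, θ' (θ b) = b) (hθ'θ : ∀ g, θ (θ' g) = g) :
    Function.Bijective ((tateDualComap e).comp (θ.comp e)) :=
  ⟨Function.LeftInverse.injective (g := e'.comp (θ'.comp (tateDualComap e')))
      (transportedSelfDual_left_inv e e' θ θ' hee' he'e hθθ'),
    Function.RightInverse.surjective (g := e'.comp (θ'.comp (tateDualComap e')))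
      (transportedSelfDual_right_inv e e' θ θ' hee' he'e hθ'θ)⟩

end SelfDual

end Summit.BirchSwinnertonDyer.Rank1Residual.GaloisImage.Transport

end
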